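import Summits.Ventures.PackingBounds.ThreePointCert.K5Cert

/-!
# κ(5) ≤ 45 (three-point bound, kernel-checked): kernel validation of Gram block R0 (chunks 7–12 of 16)

Framing: lottery ticket; floor = certified bounds/negative ranges. Venture `PackingBounds` (cell
`pub-packcert`), three-point SDP family. Integer data of a feasible point of the Bachoc–Vallentin
semidefinite program (n = 5, s = 1/2, degree d = 8, symmetric
sums of squares), derived by `pub-packcert-sdp/code/cert2lean.py` from the exact rational
certificate `sdp-n5-d8-s1-2-sym.json` of the cell (two independent exact verifiers + referee), in the
units of the kernel checker `ThreePointCert.Check` (soundness `ThreePointCert.Sound`). Generated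
file: plain lists of integers / monomials.
-/

namespace Summit.Ventures.PackingBounds.ThreePointCert.K5

open Literature.Geometry.DiscreteGeometry Literature.Geometry.DiscreteGeometry.PolyCert PolyCert.SPoly

set_option maxHeartbeats 0 in
/-- Block `R0`: rows from 93 (8 rows) of `zᵀ(LLᵀ)z` added to `dR0c6` give `dR0c7` (kernel). -/
theorem okR0_7 : chunkOK gR0 93 8 dR0c6 dR0c7 = true := by
  decide +kernel

set_option maxHeartbeats 0 in
/-- Block `R0`: rows from 101 (8 rows) of `zᵀ(LLᵀ)z` added to `dR0c7` give `dR0c8` (kernel). -/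
theorem okR0_8 : chunkOK gR0 101 8 dR0c7 dR0c8 = true := by
  decide +kernel

set_option maxHeartbeats 0 in
/-- Block `R0`: rows from 109 (8 rows) of `zᵀ(LLᵀ)z` added to `dR0c8` give `dR0c9` (kernel). -/
theorem okR0_9 : chunkOK gR0 109 8 dR0c8 dR0c9 = true := by
  decide +kernel

set_option maxHeartbeats 0 in
/-- Block `R0`: rows from 117 (7 rows) of `zᵀ(LLᵀ)z` added to `dR0c9` give `dR0c10` (kernel). -/
theorem okR0_10 : chunkOK gR0 117 7 dR0c9 dR0c10 = true := by
  decide +kernel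

set_option maxHeartbeats 0 in
/-- Block `R0`: rows from 124 (7 rows) of `zᵀ(LLᵀ)z` added to `dR0c10` give `dR0c11` (kernel). -/
theorem okR0_11 : chunkOK gR0 124 7 dR0c10 dR0c11 = true := by
  decide +kernel

set_option maxHeartbeats 0 in
/-- Block `R0`: rows from 131 (7 rows) of `zᵀ(LLᵀ)z` added to `dR0c11` give `dR0c12` (kernel). -/
theorem okR0_12 : chunkOK gR0 131 7 dR0c11 dR0c12 = true := by
  decide +kernel

end Summit.Ventures.PackingBounds.ThreePointCert.K5
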